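import Summits.ABC.IUTFork.Cor312TeamAChain
import Summits.ABC.IUTFork.Cor312LogKummerRoute
import HarnessLib

/-!
# [IUTchIII] Cor. 3.12 — row A-5: honest readings for the ten nodes before Step (x), and the census collapse

Record-only file (D-0012) of the abc-iut cell (Cor. 3.12 STRATEGY TEAM A «direct III§3», D-0067, seat
abc-iut-c312-9 = A1, row A-5 of `HOME/plan/C312-TEAMS.md`); TAKES NO SIDE. The full-chain census
(`Cor312TeamAChain.teamA_chain`) consumes the readings of the sixteen observations drawn by the opening
paragraph and Steps (i)–(ix) as GRANTED hypotheses. This file types them honestly, one `Prop` per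
observation, under the team's NO-INFLATION RULE (nothing narrative is dressed as content; where the real
content lives elsewhere in the frozen tree, the docstring points there and the reading here carries only
what the DOWNSTREAM nodes actually consume):

* the one pre-(x) observation with DOWNSTREAM LOAD is Step (i)'s `valueGroupMapsPilots` (consumed by
  (xi-a) through the `VG`-wire of `stepXIa_holds`): its reading is `Nonempty (LinkGluing P)` — the
  value-group gluing DATA of Step (xi-a) exists. This is PROVABLE OUTRIGHT (`linkGluing_nonempty`: the
  constant map at the `q`-pilot is such a datum) and therefore carries NO region or volume content — the
  print's Def. 3.8 (ii) sentence holds at the object level for free, which is LANA Rem. 8.2.1's vacuity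
  point and exactly why the dispute sits at (xi-f), not (i). The docstring says so; nothing is smuggled.
* the other fifteen observations are NARRATIVE at this typing level (their mathematical content enters the
  chain through the LOCI — the frozen definitions and FACT-LIST facts — not through these observation
  slots; `Step.concl_unique` + the `uses` lists show what little is passed on, and `Cor312TeamAChain`'s
  per-node provenance consumes none of it beyond the implications typed here): their readings are `True`
  with a pointer docstring each.
* `OPreX` — the overlay installing these sixteen readings over any base reading; `teamA_chain_OPreX` —
  the census collapse: for the overlay, the twelve pre-(x) hypotheses of `teamA_chain` DISCHARGE
  OUTRIGHT, shortening the census to: the Step (x) real discharges (`hIndAdm`/`hIndVol`/`hMono`/`hKumA`,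
  Team B), the (xi-a)–(xi-e) wires, and the tail (`hgap` — THE GAP, `htw`, `hh`, `hx`).

[claim: Mochizuki2012, status: disputed] Deliberately NOT here: any volume or region content for the
pre-(x) nodes (there is none at this level — that is the point); any claim about (xi-f); any judgement.
-/

namespace Summit.ABC

namespace IUTFork

namespace Cor312Vol

namespace PreX

open Cor312Proof Thm311 Cor312 StepXI Literature.IUT.LogThetaLattice

variable {T : ThetaIndex} {S : Situation T} (P : Cor312.Setting S)

/-- **The value-group gluing data exists** (Step (i)'s `valueGroupMapsPilots`, read at the object level:
Def. 3.8 (ii) / Rmk. 3.8.1 — "the value group portion maps Θ-pilot objects to `q`-pilot objects"): the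
constant map at the `q`-pilot is a `LinkGluing`. PROVABLE — the existence carries no content (the full
poly-isomorphism the print rides makes ANY choice admissible at this level: LANA Rem. 8.2.1, Thm311's
`partIIIa_holds` tautology); WHICH map the print intends, and what it does to REGIONS, is the (xi-f)
content (`SoundAtInput`), not Step (i)'s. [folklore] -/
theorem linkGluing_nonempty : Nonempty (LinkGluing P) :=
  ⟨⟨fun _ => P.qPilot, rfl⟩⟩

/-- The sixteen pre-(x) observation readings: `valueGroupMapsPilots` ↦ the gluing-data existence (the one
slot with downstream load, (xi-a)); every other pre-(x) observation ↦ `True` (narrative at this typing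
level — its content enters through the loci; docstring rule of the module). Observations of Step (x) and
later are passed to the base reading. [claim: Mochizuki2012, status: disputed] -/
def OPreX (base : Obs → Prop) : Obs → Prop := fun o =>
  match o with
  | .restrictToStrips => True
  | .linkSplits => True
  | .valueGroupMapsPilots => Nonempty (LinkGluing P)
  | .unitsSubjectInd12 => True
  | .cyclotomesInsulated => True
  | .singleLinkNecessary => True
  | .verticalShiftSolved => True
  | .unitsRelatedContainers => True
  | .frobeniusLikeRelatedToCoric => True
  | .logKummerViaGaloisEvaluation => True
  | .conjSyncLogLinkCompatible => True
  | .cycRigidityApproaches => True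
  | .symmetriesSeparate => True
  | .symmetriesMultiradial => True
  | .conjugacyIndetResolved => True
  | .fmodTranslation => True
  | o => base o

/-- **The census collapse**: for the `OPreX` overlay the twelve pre-(x) hypotheses of
`Cor312TeamAChain.teamA_chain` discharge outright, and the chain needs exactly: the Step (x) loci-side
real discharges, the (xi-a)–(xi-e) wires against the base reading, and the tail — with the (xi-a) `VG`
slot instantiated by the gluing-data existence itself. [claim: Mochizuki2012, status: disputed] -/
theorem teamA_chain_OPreX (C : Column S.L) (D : ThetaLinkStrips P.LogLink P.Strip)
    {L : Locus → Prop} (base : Obs → Prop)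
    (hIndAdm : ∀ Φ ∈ S.L.Ind1Family ∪ S.L.Ind2Family, ∀ (j : T.Label) (vQ : T.VQ)
      (A : Set (S.L.Packet j vQ)), (S.D P.n).Adm j vQ A ↔ (S.D P.n).Adm j vQ (Φ j vQ '' A))
    (hIndVol : (S.D P.n).LogvolInvariant)
    (hMono : ∀ (j : T.Label) (vQ : T.VQ) (A B : Set (S.L.Packet j vQ)),
      (S.D P.n).Adm j vQ A → (S.D P.n).Adm j vQ B → A ⊆ B →
        (S.D P.n).logvol j vQ A ≤ (S.D P.n).logvol j vQ B)
    (hKumA : C.KummerA (S.D P.n))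
    (hO1 : StepX.KummerDetach P → OPreX P base .kummerDetachmentInd123)
    (hO2 : StepX.LogvolCoarse P → OPreX P base .logvolInvariantInequality)
    (hO3 : StepX.LogvolLogLink P C → OPreX P base .logvolLogLinkCompatible)
    (hO4 : StepX.TensorMultZ P → OPreX P base .tensorIdentifiesMultZ)
    (hNE : ∀ n m : ℤ, Nonempty (P.IsoS (D.stripLGP (P.lattice.logLink n (m - 1)))
      (D.stripDelta (P.lattice.theater (n + 1) m))))
    (hOxia : LinkAsGluing P D (Nonempty (LinkGluing P)) → OPreX P base .linkAsGluing)
    {CIPL CSHE : Prop} (hIPL : L .IPL → CIPL) (hSHE : L .SHE → CSHE)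
    (hOb1 : OutputIPLSHE CIPL CSHE → OPreX P base .outputSatisfiesIPLSHE)
    (hOb2 : ValueGroupFullPoly P D → OPreX P base .valueGroupLinkFullPolyIso)
    (hOb3 : OnlyQualitative → OPreX P base .onlyQualitative)
    (hIPLrev : OPreX P base .outputSatisfiesIPLSHE → OutputIPLSHE CIPL CSHE)
    (hOc1 : DisplayXIc P D CIPL CSHE → OPreX P base .displayXIc)
    (hOc2 : HullComparable P → OPreX P base .hullGivesVectorBundles)
    (hXIde : P.AgreesXIde (OPreX P base)) (hfin : P.ThetaFinite) (hq : P.AbsLogQPos)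
    (hgap : OPreX P base .displayXIe → OPreX P base .sheMeansFixedValue →
      OPreX P base .constitutesConstruction)
    (htw : OPreX P base .twoEquivalentWays) (hh : OPreX P base .noNthPower)
    (hx : OPreX P base .globalFrobenioidsNeeded) :
    Chain L (OPreX P base) :=
  teamA_chain C D trivial trivial (linkGluing_nonempty P) trivial trivial trivial
    (fun _ => trivial) (fun _ => ⟨trivial, trivial⟩) (fun _ => ⟨trivial, trivial, trivial⟩)
    (fun _ => ⟨trivial, trivial⟩) (fun _ => trivial) (fun _ _ => trivial)
    hIndAdm hIndVol hMono hKumA hO1 hO2 hO3 hO4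
    (fun h => h) hNE hOxia hIPL hSHE hOb1 hOb2 hOb3 hIPLrev hOc1 hOc2 hXIde hfin hq hgap htw hh hx

end PreX

end Cor312Vol

end IUTFork

end Summit.ABC
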